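import Mathlib.NumberTheory.Harmonic.Bounds
import Mathlib.Analysis.SpecialFunctions.Trigonometric.DerivHyp
import Mathlib.Analysis.SpecialFunctions.Pow.Real
import Mathlib.Algebra.BigOperators.Intervals
import Mathlib.Algebra.Order.Interval.Finset.SuccPred
import HarnessLib

/-!
# Perron rows of Bombieri's off-diagonal kernel in closed form (STUB-PLAN `stub_windowCore`, helper B2a)

Crux `WeilComb.CombShapePositivity` (item stmt-RiemannHypothesis-11229), line `Sketch`, STUB-PLAN
`stub_windowCore` Phase B, helper B2a (`gker_log_ratio`, `perron_arch_rowSum` of the typed companion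
`Cruxes/CombShapePositivity/SketchStubPlanWindowCore.lean`; the harmonic identity behind the landed
`stub_offdiagSchur`, p109602). Bombieri's off-diagonal kernel is `g(t) = e^{t/2}/(2 sinh t)`; at
`t = log(m/m')` against the Perron ray `u_{m'} = m'^{-1/2}`:

* `gker_log_ratio` — `g(log m − log m') · m'^{-1/2} = m√m/(m² − m'²)` (`0 < m' < m`);
* `stub_perronArchRowSum` (registered on the crux) — the full Perron row in closed form: for `1 ≤ m ≤ M`,
  `Σ_{1 ≤ m' < m} m√m/(m² − m'²) + Σ_{m < m' ≤ M} m'√m/(m'² − m²) = (√m/2)(H_{M−m} + H_{M+m} − 3/(2m))`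
  (partial fractions `m/(m² − m'²) = ½(1/(m−m') + 1/(m+m'))`, `m'/(m'² − m²) = ½(1/(m'−m) + 1/(m'+m))`,
  then four blocks of the harmonic series).
-/

noncomputable section

-- the sub-problem path RiemannHypothesis/RiemannHypothesis duplicates a namespace (D-0017)
set_option linter.dupNamespace false

open Finset

namespace Summit.RiemannHypothesis.RiemannHypothesis.Theorems.WeilCombPerronArchRows

/-! ### The kernel at a log-ratio -/

/-- **B2a, kernel value**: for naturals `0 < m' < m`,
`e^{t/2}/(2 sinh t) · m'^{-1/2} = m√m/(m² − m'²)` at `t = log m − log m'`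
(`e^{t/2} = √(m/m')`, `2 sinh t = m/m' − m'/m`). [folklore] -/
theorem gker_log_ratio (m m' : ℕ) (hm' : 0 < m') (hlt : m' < m) :
    Real.exp ((Real.log m - Real.log m') / 2) / (2 * Real.sinh (Real.log m - Real.log m')) *
        (Real.sqrt (m' : ℝ))⁻¹ =
      (m : ℝ) * Real.sqrt (m : ℝ) / ((m : ℝ) ^ 2 - (m' : ℝ) ^ 2) := by
  have hm0 : (0 : ℝ) < m := by exact_mod_cast (hm'.trans hlt)
  have hm'0 : (0 : ℝ) < m' := by exact_mod_cast hm'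
  have hlt' : (m' : ℝ) < m := by exact_mod_cast hlt
  have hsm : 0 < Real.sqrt m := Real.sqrt_pos.2 hm0
  have hsm' : 0 < Real.sqrt m' := Real.sqrt_pos.2 hm'0
  have hexp2 : Real.exp ((Real.log m - Real.log m') / 2) = Real.sqrt m / Real.sqrt m' := by
    rw [sub_div, Real.exp_sub, Real.sqrt_eq_rpow, Real.sqrt_eq_rpow, Real.rpow_def_of_pos hm0,
      Real.rpow_def_of_pos hm'0]
    congr 1 <;> congr 1 <;> ring
  have hsinh : 2 * Real.sinh (Real.log m - Real.log m') = (m : ℝ) / m' - (m' : ℝ) / m := by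
    rw [Real.sinh_eq, neg_sub, Real.exp_sub, Real.exp_sub, Real.exp_log hm0, Real.exp_log hm'0]
    ring
  rw [hexp2, hsinh]
  have hden : (m : ℝ) / m' - (m' : ℝ) / m = ((m : ℝ) ^ 2 - (m' : ℝ) ^ 2) / ((m : ℝ) * m') := by
    field_simp
  have hne : (m : ℝ) ^ 2 - (m' : ℝ) ^ 2 ≠ 0 := by nlinarith
  rw [hden]
  field_simp
  rw [Real.sq_sqrt hm'0.le]

/-! ### The Perron row: four harmonic blocks -/

/-- `Σ_{i ∈ (a, c]} = Σ_{i ∈ (a, b]} + Σ_{i ∈ (b, c]}` for `a ≤ b ≤ c` (reals). [folklore] -/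
private theorem sum_Ioc_split (f : ℕ → ℝ) {a b c : ℕ} (hab : a ≤ b) (hbc : b ≤ c) :
    ∑ i ∈ Ioc a c, f i = ∑ i ∈ Ioc a b, f i + ∑ i ∈ Ioc b c, f i :=
  (Finset.sum_Ioc_consecutive f hab hbc).symm

/-- `Σ_{i ∈ (b, b+1]} f = f(b+1)`. [folklore] -/
private theorem sum_Ioc_succ (f : ℕ → ℝ) (b : ℕ) : ∑ i ∈ Ioc b (b + 1), f i = f (b + 1) := by
  rw [Nat.Ioc_succ_singleton, Finset.sum_singleton]

/-- `H_n = Σ_{i ∈ (0, n]} 1/i` over `ℝ`. [folklore] -/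
private theorem harmonic_cast_eq (n : ℕ) : (harmonic n : ℝ) = ∑ i ∈ Ioc 0 n, (1 : ℝ) / i := by
  rw [harmonic_eq_sum_Icc, show Finset.Icc 1 n = Finset.Ioc 0 n from Finset.Icc_add_one_left_eq_Ioc 0 n]
  push_cast
  refine Finset.sum_congr rfl fun k _ ↦ ?_
  rw [one_div]

/-- The lower block of the first sum: `Σ_{1 ≤ j < m} 1/(m − j) = Σ_{0 < i ≤ m−1} 1/i`. [folklore] -/
private theorem sum_Ico_inv_sub (m : ℕ) (hm : 1 ≤ m) :
    ∑ j ∈ Ico 1 m, (1 : ℝ) / ((m : ℝ) - j) = ∑ i ∈ Ioc 0 (m - 1), (1 : ℝ) / i := by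
  have h1 : ∑ j ∈ Ico 1 m, (1 : ℝ) / ((m : ℝ) - j) = ∑ j ∈ Ico 1 m, (fun i : ℕ ↦ (1 : ℝ) / i) (m - j) := by
    refine Finset.sum_congr rfl fun j hj ↦ ?_
    obtain ⟨-, hj2⟩ := Finset.mem_Ico.1 hj
    beta_reduce
    rw [Nat.cast_sub hj2.le]
  rw [h1, Finset.sum_Ico_reflect (fun i : ℕ ↦ (1 : ℝ) / i) 1 (show m ≤ m + 1 by omega)]
  have h2 : Ico (m + 1 - m) (m + 1 - 1) = Ioc 0 (m - 1) := by
    rw [show m + 1 - m = 0 + 1 by omega, show m + 1 - 1 = (m - 1) + 1 by omega,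
      Finset.Ico_add_one_add_one_eq_Ioc]
  rw [h2]

/-- The upper block of the first sum: `Σ_{1 ≤ j < m} 1/(m + j) = Σ_{m < i ≤ 2m−1} 1/i`. [folklore] -/
private theorem sum_Ico_inv_add (m : ℕ) (hm : 1 ≤ m) :
    ∑ j ∈ Ico 1 m, (1 : ℝ) / ((m : ℝ) + j) = ∑ i ∈ Ioc m (2 * m - 1), (1 : ℝ) / i := by
  have h1 : ∑ j ∈ Ico 1 m, (1 : ℝ) / ((m : ℝ) + j) = ∑ j ∈ Ico 1 m, (fun i : ℕ ↦ (1 : ℝ) / i) (m + j) := by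
    refine Finset.sum_congr rfl fun j _ ↦ ?_
    push_cast
    ring
  rw [h1, Finset.sum_Ico_add (fun i : ℕ ↦ (1 : ℝ) / i) 1 m m]
  have h2 : Ico (1 + m) (m + m) = Ioc m (2 * m - 1) := by
    rw [show 1 + m = m + 1 by omega, show m + m = (2 * m - 1) + 1 by omega,
      Finset.Ico_add_one_add_one_eq_Ioc]
  rw [h2]

/-- The lower block of the second sum: `Σ_{m < j ≤ M} 1/(j − m) = Σ_{0 < i ≤ M−m} 1/i`. [folklore] -/
private theorem sum_Ioc_inv_sub (M m : ℕ) (hmM : m ≤ M) :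
    ∑ j ∈ Ioc m M, (1 : ℝ) / ((j : ℝ) - m) = ∑ i ∈ Ioc 0 (M - m), (1 : ℝ) / i := by
  have h := Finset.sum_Ico_add (fun j : ℕ ↦ (1 : ℝ) / ((j : ℝ) - m)) 1 (M - m + 1) m
  have h1 : Ico (1 + m) (M - m + 1 + m) = Ioc m M := by
    rw [show 1 + m = m + 1 by omega, show M - m + 1 + m = M + 1 by omega,
      Finset.Ico_add_one_add_one_eq_Ioc]
  rw [h1] at h
  have h2 : Finset.Ico 1 (M - m + 1) = Finset.Ioc 0 (M - m) := by
    simpa using Finset.Ico_add_one_add_one_eq_Ioc 0 (M - m)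
  rw [← h, h2]
  refine Finset.sum_congr rfl fun i _ ↦ ?_
  push_cast
  ring

/-- The upper block of the second sum: `Σ_{m < j ≤ M} 1/(j + m) = Σ_{2m < i ≤ M+m} 1/i`. [folklore] -/
private theorem sum_Ioc_inv_add (M m : ℕ) :
    ∑ j ∈ Ioc m M, (1 : ℝ) / ((j : ℝ) + m) = ∑ i ∈ Ioc (2 * m) (M + m), (1 : ℝ) / i := by
  have h1 : ∑ j ∈ Ioc m M, (1 : ℝ) / ((j : ℝ) + m) =
      ∑ j ∈ Ico (m + 1) (M + 1), (fun i : ℕ ↦ (1 : ℝ) / i) (j + m) := by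
    rw [Finset.Ico_add_one_add_one_eq_Ioc]
    refine Finset.sum_congr rfl fun j _ ↦ ?_
    push_cast
    ring
  rw [h1, Finset.sum_Ico_add' (fun i : ℕ ↦ (1 : ℝ) / i) (m + 1) (M + 1) m]
  have h2 : Ico (m + 1 + m) (M + 1 + m) = Ioc (2 * m) (M + m) := by
    rw [show m + 1 + m = 2 * m + 1 by omega, show M + 1 + m = (M + m) + 1 by omega,
      Finset.Ico_add_one_add_one_eq_Ioc]
  rw [h2]

/-- **Stub `stub_perronArchRowSum` (B2a; registered on crux stmt-RiemannHypothesis-11229) — the Perron row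
of Bombieri's off-diagonal kernel in closed form.** For `1 ≤ m ≤ M`,
`Σ_{1 ≤ m' < m} m√m/(m² − m'²) + Σ_{m < m' ≤ M} m'√m/(m'² − m²) = (√m/2)(H_{M−m} + H_{M+m} − 3/(2m))`.
[folklore] -/
theorem stub_perronArchRowSum : ∀ (M m : ℕ), 1 ≤ m → m ≤ M →
    ∑ m' ∈ Finset.Ico 1 m, (m : ℝ) * Real.sqrt (m : ℝ) / ((m : ℝ) ^ 2 - (m' : ℝ) ^ 2) +
      ∑ m' ∈ Finset.Ioc m M, (m' : ℝ) * Real.sqrt (m : ℝ) / ((m' : ℝ) ^ 2 - (m : ℝ) ^ 2) =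
      Real.sqrt (m : ℝ) / 2 *
        ((harmonic (M - m) : ℝ) + (harmonic (M + m) : ℝ) - 3 / (2 * (m : ℝ))) := by
  intro M m hm hmM
  have hm0 : (0 : ℝ) < m := by exact_mod_cast hm
  -- partial fractions, first sum
  have h1 : ∑ m' ∈ Finset.Ico 1 m, (m : ℝ) * Real.sqrt (m : ℝ) / ((m : ℝ) ^ 2 - (m' : ℝ) ^ 2) =
      Real.sqrt m / 2 * (∑ j ∈ Ico 1 m, (1 : ℝ) / ((m : ℝ) - j) + ∑ j ∈ Ico 1 m, (1 : ℝ) / ((m : ℝ) + j)) := by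
    rw [← Finset.sum_add_distrib, Finset.mul_sum]
    refine Finset.sum_congr rfl fun j hj ↦ ?_
    obtain ⟨-, hj2⟩ := Finset.mem_Ico.1 hj
    have hj' : (j : ℝ) < m := by exact_mod_cast hj2
    have hj0 : (0 : ℝ) ≤ j := Nat.cast_nonneg j
    have ha : (m : ℝ) - j ≠ 0 := by linarith
    have hb : (m : ℝ) + j ≠ 0 := by linarith
    have hc : (m : ℝ) ^ 2 - (j : ℝ) ^ 2 ≠ 0 := by
      rw [sq_sub_sq]; exact mul_ne_zero hb ha
    field_simp
    ring
  -- partial fractions, second sum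
  have h2 : ∑ m' ∈ Finset.Ioc m M, (m' : ℝ) * Real.sqrt (m : ℝ) / ((m' : ℝ) ^ 2 - (m : ℝ) ^ 2) =
      Real.sqrt m / 2 * (∑ j ∈ Ioc m M, (1 : ℝ) / ((j : ℝ) - m) + ∑ j ∈ Ioc m M, (1 : ℝ) / ((j : ℝ) + m)) := by
    rw [← Finset.sum_add_distrib, Finset.mul_sum]
    refine Finset.sum_congr rfl fun j hj ↦ ?_
    obtain ⟨hj1, -⟩ := Finset.mem_Ioc.1 hj
    have hj' : (m : ℝ) < j := by exact_mod_cast hj1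
    have ha : (j : ℝ) - m ≠ 0 := by linarith
    have hb : (j : ℝ) + m ≠ 0 := by linarith
    have hc : (j : ℝ) ^ 2 - (m : ℝ) ^ 2 ≠ 0 := by
      rw [sq_sub_sq]; exact mul_ne_zero hb ha
    field_simp
    ring
  rw [h1, h2, sum_Ico_inv_sub m hm, sum_Ico_inv_add m hm, sum_Ioc_inv_sub M m hmM, sum_Ioc_inv_add M m,
    harmonic_cast_eq, harmonic_cast_eq]
  -- the telescoping bookkeeping: `S(0,M+m) = S(0,m−1) + 1/m + S(m,2m−1) + 1/(2m) + S(2m,M+m)`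
  set f : ℕ → ℝ := fun i ↦ (1 : ℝ) / i with hf
  have e1 : ∑ i ∈ Ioc 0 (M + m), f i = ∑ i ∈ Ioc 0 (m - 1), f i + ∑ i ∈ Ioc (m - 1) (M + m), f i :=
    sum_Ioc_split f (Nat.zero_le _) (by omega)
  have e2 : ∑ i ∈ Ioc (m - 1) (M + m), f i = ∑ i ∈ Ioc (m - 1) m, f i + ∑ i ∈ Ioc m (M + m), f i :=
    sum_Ioc_split f (Nat.sub_le m 1) (by omega)
  have e3 : ∑ i ∈ Ioc (m - 1) m, f i = 1 / (m : ℝ) := by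
    have := sum_Ioc_succ f (m - 1)
    rw [show m - 1 + 1 = m by omega] at this
    rw [this]
  have e4 : ∑ i ∈ Ioc m (M + m), f i = ∑ i ∈ Ioc m (2 * m - 1), f i + ∑ i ∈ Ioc (2 * m - 1) (M + m), f i :=
    sum_Ioc_split f (by omega) (by omega)
  have e5 : ∑ i ∈ Ioc (2 * m - 1) (M + m), f i =
      ∑ i ∈ Ioc (2 * m - 1) (2 * m), f i + ∑ i ∈ Ioc (2 * m) (M + m), f i :=
    sum_Ioc_split f (by omega) (by omega)
  have e6 : ∑ i ∈ Ioc (2 * m - 1) (2 * m), f i = 1 / (2 * (m : ℝ)) := by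
    have := sum_Ioc_succ f (2 * m - 1)
    rw [show 2 * m - 1 + 1 = 2 * m by omega] at this
    rw [this, hf]
    push_cast
    ring
  simp only [hf] at e1 e2 e3 e4 e5 e6
  rw [e1, e2, e3, e4, e5, e6]
  ring

end Summit.RiemannHypothesis.RiemannHypothesis.Theorems.WeilCombPerronArchRows

end
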